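import Summits.ResolutionOfSingularities.ResolutionOfSingularities.Theorems.FrobeniusClosingSteerSwitchBinaryLateSwitchRun
import Summits.ResolutionOfSingularities.ResolutionOfSingularities.Theorems.FrobeniusClosingSteerArithLeafWords
import HarnessLib

/-!
# hARᵒ H2 — the word `ArithLeaf.LateSwitchBinaryAStageTwoN` WITH ONE EXTRA BINDER (rational point windows) is a theorem
# (plumbing from the run-level glue `BinaryResidue.lateBinaryAStage_of_run`; Theses-free, def-free)

OURS (campaign `res-hironaka`, rung L ★L-G4, slot W4.1 · crux `Steer` (stmt-ResolutionOfSingularities-16345) · hARᵒ slot H2; seat res-D-repro-2 g9, P0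
main hand; words by res-L0-w41-strat-2 / filed res-D-lib-2 p559461). `lateSwitchBinaryAStage_of_rationalWindows` has EXACTLY the binder telescope of
`ArithLeaf.LateSwitchBinaryAStageTwoN` with ONE binder inserted after Hγ — «beyond `N₁` every point window is RATIONAL:
`∀ j j′ ≥ N₁ visit pair, ∀ a ∈ R j′, ∃ b ∈ R j, v(a − b) < 1`» — and the word's conclusion. What it uses of the telescope: `CharP k 2` (⇒ `CharP K 2`),
`R 0 = locAtCentre A₀ O` (⇒ `R 0` dominated), the steered run, the weak-persistence failure (hnp), regularity / dimension 4, N4's height-one clause, Hγ,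
the S1b data `(d, i₁)`; the other binders are carried unused. So the word itself is reduced to the RESIDUALLY NON-RATIONAL late windows
(res-L0-w41-plan-1 RULING 185f's «residue word»): either a word/lemma supplying rationality of late point windows, or an on-axis binary datum in the
non-rational case. Not a statement of the manuscript under review [claim: Hironaka2017, status: under-review]; AI-produced, weaker than expert review.
[folklore]
-/

noncomputable section

-- `Summit.<S>.<S>.…` duplicates the summit name by design (single-problem summit).
set_option linter.dupNamespace false

open IsLocalRing
open Literature.AlgebraicGeometry.Resolution
open Summit.ResolutionOfSingularities.ResolutionOfSingularities.Theorems.SwitchingDichotomy.Words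
open Summit.ResolutionOfSingularities.ResolutionOfSingularities.Theorems.SteerRankThinness (Concl HasProperCoarsening)
open Summit.ResolutionOfSingularities.ResolutionOfSingularities.Theorems.SwitchingDichotomy.ArithReduction
open Summit.ResolutionOfSingularities.ResolutionOfSingularities.Theorems.SwitchingDichotomy

namespace Summit.ResolutionOfSingularities.ResolutionOfSingularities.Theorems.SwitchingDichotomy.BinaryResidue


/-- **`LateSwitchBinaryAStageTwoN` with rational late point windows.** The word's binder telescope with ONE extra binder (rationality of the
point windows beyond `N₁`, value form) implies the word's conclusion, by `lateBinaryAStage_of_run`. [folklore] -/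
theorem lateSwitchBinaryAStage_of_rationalWindows :
  ∀ p : ℕ, p = 2 →
    ∀ (k K : Type) [Field k] [CharP k p] [PerfectField k] [Field K] [Algebra k K]
    (O : ValuationSubring K) (A₀ : Subalgebra k K) (h₀ : A₀.toSubring ≤ O.toSubring) (t : K),
    CoreDatum p 4 k K O A₀ h₀ t → ¬ HasProperCoarsening O →
    ∀ (R : ℕ → Subring K) (P : (i : ℕ) → Ideal (R i)) (s : ℕ → K),
      R 0 = locAtCentre A₀.toSubring O → NormalAt O (R 0) p t → IsSteeredRun O R P t p s →
      (¬ ∃ i₀ c : ℕ, 1 ≤ c ∧ IsDominantTail R P i₀ c) →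
      (∃ i₀ : ℕ, ∀ i, i₀ ≤ i → IsHighOrderAt R s p i) →
      ¬ HeightTwoStepsInfinite R P → {j | IsPosStep R P j}.Infinite →
      (∀ i₀ : ℕ, ∃ i, i₀ ≤ i ∧ IsPointStep R P i ∧
        ∀ hs : s i ^ p ∈ R i, ¬ HasIsolatedSingularity (RadicandRing (R i) p ⟨s i ^ p, hs⟩)) →
      (¬ ∃ i₀ : ℕ, ∃ x : K, x ≠ 0 ∧ x ∈ O ∧ O.valuation x < 1 ∧
        ∀ i, i₀ ≤ i → ∀ y ∈ R i, O.valuation y < 1 → ∃ j, i < j ∧ y / x ∈ R j) →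
      (∀ i₀ : ℕ, ∃ i, i₀ ≤ i ∧ OddCleanedPointStepAt R P s p i) →
      (∀ i, IsRegularLocalRing (R i)) → (∀ i, ringKrullDim (R i) = (4 : ℕ)) →
      ∀ N₁ : ℕ,
      (∀ j, N₁ ≤ j → IsPointStep R P j → ∀ (hs' : s j ^ p ∈ R j) (Q : Ideal (R j)) [Q.IsPrime], Q.height = 0 →
          ¬ SigmaTopLegality.IsSingPrime (R j) p ⟨s j ^ p, hs'⟩ Q) →
      (∀ j, N₁ ≤ j → IsPointStep R P j → ∀ (hs' : s j ^ p ∈ R j) (Q : Ideal (R j)) [Q.IsPrime], Q.height = 1 →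
          ¬ SigmaTopLegality.IsSingPrime (R j) p ⟨s j ^ p, hs'⟩ Q) →
      (∀ (j j' : ℕ) (x : K), N₁ ≤ j → IsVisitPair R P j j' →
        ((∃ h : x ∈ R j, (⟨x, h⟩ : R j) ∈ P j) ∧ x ≠ 0 ∧ ∀ y : R j, y ∈ P j → O.valuation (y : K) ≤ O.valuation x) →
        ∀ l, j < l → l < j' → ∃ hx : x ∈ R l, P l = Ideal.span {(⟨x, hx⟩ : R l)}) →
      -- the EXTRA binder (not in the word): RATIONAL point windows beyond `N₁`, value form
      (∀ (j j' : ℕ), N₁ ≤ j → IsVisitPair R P j j' → ∀ a ∈ R j', ∃ b ∈ R j, O.valuation (a - b) < 1) →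
      ∀ (d i₁ : ℕ), Odd d → 3 ≤ d →
      (∀ i, i₁ ≤ i → IsPointStep R P i → HasReducedOrderAt R s p i d) →
      (∀ i₀, ∃ i, i₀ ≤ i ∧ IsAStageAt R P s p i d) →
      ∀ i₀ : ℕ, ∃ i, i₀ ≤ i ∧ IsAStageAt R P s p i d ∧
        ∃ (_ : IsLocalRing (R i)) (hs : s i ^ p ∈ R i) (g m₁ m₂ : R i) (Ψ : MvPolynomial (Fin 2) (R i)) (u : K),
          IsRsopPart ![m₁, m₂] ∧ Ψ.IsHomogeneous d ∧
          (⟨s i ^ p, hs⟩ : R i) - g ^ 2 - MvPolynomial.eval ![m₁, m₂] Ψ ∈ maximalIdeal (R i) ^ (d + 1) ∧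
          ((∃ hu : u ∈ R i, (⟨u, hu⟩ : R i) ∈ P i) ∧ u ≠ 0 ∧ ∀ y : R i, y ∈ P i → O.valuation (y : K) ≤ O.valuation u) ∧
          O.valuation (m₁ : K) < O.valuation u ∧ O.valuation (m₂ : K) < O.valuation u := by
  intro p hp2 k K _ _ _ _ _ O A₀ h₀ t core hrk R P s hR0 hN hrun hnd hhigh h2inf hinf hwild hnp hodd hreg hdim N₁ h0 h1 HΓ hrat
    d i₁ hdo hd3 hred hA i₀
  subst hp2
  haveI : CharP K 2 := charP_of_injective_algebraMap (algebraMap k K).injective 2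
  have hdom0 : SubringDominates (R 0) O.toSubring := by
    rw [hR0]
    exact subringDominates_locAtCentre h₀
  -- one late bound for N4, Hγ, rationality and the reduced order
  set N := max N₁ i₁ with hNdef
  have h1' : ∀ j, N ≤ j → IsPointStep R P j → ∀ (hs' : s j ^ 2 ∈ R j) (Q : Ideal (R j)) [Q.IsPrime], Q.height = 1 →
      ¬ SigmaTopLegality.IsSingPrime (R j) 2 ⟨s j ^ 2, hs'⟩ Q := fun j hj => h1 j (le_of_max_le_left hj)
  have HΓ' : ∀ (j j' : ℕ) (x : K), N ≤ j → IsVisitPair R P j j' →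
      ((∃ h : x ∈ R j, (⟨x, h⟩ : R j) ∈ P j) ∧ x ≠ 0 ∧ ∀ y : R j, y ∈ P j → O.valuation (y : K) ≤ O.valuation x) →
      ∀ l, j < l → l < j' → ∃ hx : x ∈ R l, P l = Ideal.span {(⟨x, hx⟩ : R l)} := fun j j' x hj => HΓ j j' x (le_of_max_le_left hj)
  have hrat' : ∀ j j', N ≤ j → IsVisitPair R P j j' → ∀ a ∈ R j', ∃ b ∈ R j, O.valuation (a - b) < 1 :=
    fun j j' hj => hrat j j' (le_of_max_le_left hj)
  have hred' : ∀ i, N ≤ i → IsPointStep R P i → HasReducedOrderAt R s 2 i d := fun i hi => hred i (le_of_max_le_right hi)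
  exact lateBinaryAStage_of_run hrun hdom0 hreg hdim hnp h1' HΓ' hrat' hd3 hred' hA i₀

end Summit.ResolutionOfSingularities.ResolutionOfSingularities.Theorems.SwitchingDichotomy.BinaryResidue

end
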